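import Literature.Geometry.Lorentzian.KerrBoyerLindquistLeaf
import HarnessLib

/-!
# The Boyer–Lindquist slice of Kerr as a map from quasi-isotropic Cartesian coordinates, IV:
# injectivity of the leaf

Support file (all results proved; no definitions, no named facts), continuing
`KerrBoyerLindquistLeaf.lean`. The Boyer–Lindquist leaf `Kerr.BL.leaf M a b ρ₁ hM hρ₁` (the slice
`{t = 0}` of Kerr parametrised by quasi-isotropic Cartesian coordinates) is **injective**:

* `strictMonoOn_qiRadius` — the quasi-isotropic radius `R(ρ) = ρ + M + (M² − a²)/(4ρ)` is strictly
  increasing on `(ρH, ∞)` (`R′ = q/ρ > 0` there; mean value theorem);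
* `leafRep_injOn` / **`leaf_injective`** — from `leafRep x = leafRep x′`: the Kerr–Schild radii
  agree (`radius_leafRep`), so `‖x‖ = ‖x′‖`; then the third components give `x₃ = x′₃`, the first
  two give a linear system with determinant `R² + a² > 0` for the rotated horizontal coordinates,
  and un-rotating by the common twist angle gives `x = x′`.

With `…Leaf.lean` this supplies the first three clauses (injective spacelike immersion) of an exact
Kerr end (`InitialDataSet.IsExactKerrEndAlong`) for the Boyer–Lindquist slice; the future unit
normal and the second fundamental form are the business of the sequel.

References: Brandt–Seidel, Phys. Rev. D 54 (1996) 1403, §II; Boyer–Lindquist 1967.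
-/

noncomputable section

open Bundle TopologicalSpace Set Module Real Filter
open scoped InnerProductSpace Topology ContDiff Manifold

namespace Literature.Geometry.Lorentzian

namespace Kerr.BL

open Kerr.Ingoing

variable {M a b ρ₁ : ℝ}

/-- **The quasi-isotropic radius is strictly increasing beyond the threshold** `ρH`
(`R′(ρ) = q(ρ)/ρ > 0` for `ρ > ρH`). Brandt–Seidel 1996, §II. [cite: BrandtSeidel1996, §II] -/
theorem strictMonoOn_qiRadius (M a : ℝ) : StrictMonoOn (qiRadius M a) (Ioi (rhoH M a)) := by
  have hρ0 : ∀ ρ ∈ Ioi (rhoH M a), (0 : ℝ) < ρ := fun ρ hρ ↦ (rhoH_nonneg M a).trans_lt hρ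
  have hcont : ContinuousOn (qiRadius M a) (Ioi (rhoH M a)) := fun ρ hρ ↦
    (contDiffAt_qiRadius M a (hρ0 ρ hρ).ne' (n := 0)).continuousAt.continuousWithinAt
  refine strictMonoOn_of_deriv_pos (convex_Ioi _) hcont fun ρ hρ ↦ ?_
  rw [interior_Ioi] at hρ
  rw [(hasDerivAt_qiRadius M a (hρ0 ρ hρ).ne').deriv]
  exact div_pos (qiRoot_pos_of_rhoH_lt hρ) (hρ0 ρ hρ)

/-- Un-rotating: `x₁ = ξ₁ cos α + ξ₂ sin α`, `x₂ = ξ₂ cos α − ξ₁ sin α` for `ξ = rot_α(x)`. [folklore] -/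
theorem unrot_rotXY (α : ℝ) (x : E3) :
    x 0 = rotXY α x 0 * cos α + rotXY α x 1 * sin α ∧
      x 1 = rotXY α x 1 * cos α - rotXY α x 0 * sin α := by
  have h := sin_sq_add_cos_sq α
  rw [rotXY_apply_zero, rotXY_apply_one]
  constructor
  · linear_combination (-(x 0)) * h
  · linear_combination (-(x 1)) * h

/-- **The leaf map is injective on `{‖x‖ > ρH}`** (`0 ≤ M`). [cite: BrandtSeidel1996, §II] -/
theorem leafRep_injOn (hM : 0 ≤ M) (b : ℝ) :
    Set.InjOn (leafRep M a b) {x : E3 | rhoH M a < ‖x‖} := by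
  intro x hx x' hx' h
  simp only [Set.mem_setOf_eq] at hx hx'
  have hx0 : x ≠ 0 := by
    intro h0; rw [h0, norm_zero] at hx; exact absurd hx (not_lt.2 (rhoH_nonneg M a))
  have hx0' : x' ≠ 0 := by
    intro h0; rw [h0, norm_zero] at hx'; exact absurd hx' (not_lt.2 (rhoH_nonneg M a))
  have hR : 0 < qiRadius M a ‖x‖ := qiRadius_pos_of_rhoH_lt hM hx
  have hR' : 0 < qiRadius M a ‖x'‖ := qiRadius_pos_of_rhoH_lt hM hx'
  -- Step 1: equal quasi-isotropic radii, hence equal norms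
  have hrad : qiRadius M a ‖x‖ = qiRadius M a ‖x'‖ := by
    rw [← radius_leafRep M a b hx0 hR, ← radius_leafRep M a b hx0' hR', h]
  have hnorm : ‖x‖ = ‖x'‖ := (strictMonoOn_qiRadius M a).injOn hx hx' hrad
  -- Step 2: the spatial components
  have hρ0 : ‖x‖ ≠ 0 := norm_ne_zero_iff.2 hx0
  have hsp : leafSpatial M a b x = leafSpatial M a b x' := by
    rw [← spatial_leafRep M a b x, ← spatial_leafRep M a b x', h]
  have e0 := congrArg (fun y : E3 ↦ y 0) hsp
  have e1 := congrArg (fun y : E3 ↦ y 1) hsp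
  have e2 := congrArg (fun y : E3 ↦ y 2) hsp
  simp only [leafSpatial_apply_zero, leafSpatial_apply_one, leafSpatial_apply_two] at e0 e1 e2
  rw [← hnorm] at e0 e1 e2
  set R := qiRadius M a ‖x‖ with hRdef
  set G := twistBL M a b R with hGdef
  set ξ := rotXY G x with hξ
  set ξ' := rotXY G x' with hξ'
  -- third components: `x₃ = x′₃`
  have h2 : x 2 = x' 2 := by
    have h3 : R * x 2 = R * x' 2 := by
      have := (div_left_inj' hρ0).1 e2
      linarith
    exact mul_left_cancel₀ hR.ne' h3
  -- first two components: the `(R, a)`-twist is invertible (`det = R² + a²`)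
  have f0 : R * ξ 0 - a * ξ 1 = R * ξ' 0 - a * ξ' 1 := (div_left_inj' hρ0).1 e0
  have f1 : R * ξ 1 + a * ξ 0 = R * ξ' 1 + a * ξ' 0 := (div_left_inj' hρ0).1 e1
  have hdet : R ^ 2 + a ^ 2 ≠ 0 := by positivity
  have g0 : ξ 0 = ξ' 0 := by
    have : (R ^ 2 + a ^ 2) * (ξ 0 - ξ' 0) = 0 := by linear_combination R * f0 + a * f1
    rcases mul_eq_zero.1 this with h3 | h3
    · exact absurd h3 hdet
    · linarith
  have g1 : ξ 1 = ξ' 1 := by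
    have : (R ^ 2 + a ^ 2) * (ξ 1 - ξ' 1) = 0 := by linear_combination R * f1 - a * f0
    rcases mul_eq_zero.1 this with h3 | h3
    · exact absurd h3 hdet
    · linarith
  -- un-rotate
  obtain ⟨u0, u1⟩ := unrot_rotXY G x
  obtain ⟨u0', u1'⟩ := unrot_rotXY G x'
  rw [← hξ] at u0 u1
  rw [← hξ'] at u0' u1'
  ext i
  fin_cases i
  · show x 0 = x' 0
    rw [u0, u0', g0, g1]
  · show x 1 = x' 1
    rw [u1, u1', g0, g1]
  · exact h2

/-- **The Boyer–Lindquist leaf is injective.** [cite: BrandtSeidel1996, §II] -/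
theorem leaf_injective (hM : 0 ≤ M) (hρ₁ : rhoH M a ≤ ρ₁) :
    Function.Injective (leaf M a b ρ₁ hM hρ₁) := by
  intro x x' h
  have h' : leafRep M a b x = leafRep M a b x' := by
    have := congrArg (fun p : region a 0 ↦ (p : E4)) h
    simpa only [coe_leaf] using this
  exact Subtype.ext (leafRep_injOn hM b (rhoH_lt_norm hρ₁ x) (rhoH_lt_norm hρ₁ x') h')

end Kerr.BL

end Literature.Geometry.Lorentzian

end
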